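import Summits.ABC.ABC.Theorems.IneffectiveSubspaceTowerFourSubLiouvilleOfLangWaldschmidt
import Summits.ABC.ABC.Theorems.TowerFourSubLiouville.Negative.TorusBezoutCorner

/-!
# `TowerFourSubLiouville` (stmt-ABC-1649): the Lang–Waldschmidt₄ dial (S⁺5) on the crux's own linear forms — floor `1`

Negative-side module of the standing disprover (cycle 12, refuter-cdisprove-stmt-ABC-1649-g12-0, 2026-08-17), companion of
`IneffectiveSubspaceTowerFourSubLiouvilleOfLangWaldschmidt` (p111401: the edge `stub_cruxOfLangWaldschmidt`, Lang–Waldschmidt for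
four logarithms with coefficients `|bᵢ| ≤ 4` ⟹ crux) and of `Negative.TorusBezoutCorner` (p138228: the Pell–Bezout family).

The hypothesis `hLW` of the landed edge is the product form of the Lang–Waldschmidt conjecture in the instance `m = 4`, `|bᵢ| ≤ 4`:

  `∀ ε > 0, ∃ C > 0, ∀ a : Fin 4 → ℕ, b : Fin 4 → ℤ` (positive, `|bᵢ| ≤ 4`, `Λ := ∑ bᵢ log aᵢ ≠ 0`):  `C · (∏ aᵢ)^{−(1+ε)} ≤ |Λ|`.

Write `LW₄(κ)` for the same matrix with exponent `−κ` in place of `−(1+ε)` (so `hLW ⟺ ∀ ε > 0, LW₄(1+ε)`; the edge uses only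
`ε = 1/5`, and its docstring computes that any `κ < 2` would do at small `η`).  This file records the FLOOR of that dial, and it
does so on the very instances the edge feeds to `hLW` — `a = (w, Z, v, Y)`, `b = (1, 4, −1, −4)`, `Λ = log(wZ⁴/(vY⁴))` for a coprime
binomial-quartic enemy `wZ⁴ = vY⁴ + a₀`:

* `not_langWaldschmidt4_of_lt_one`: **`LW₄(κ)` is FALSE for every `κ < 1`.**  Witness: the Pell–Bezout family of
  `Negative.TorusBezoutCorner` (`(16Z²+12)Z⁴ − (4Z²−1)Y⁴ = 1`, `Y² = 2Z² + 1`): `Λ = log(1 + 1/(vY⁴)) ∈ (0, 1/(12 Z⁶)]` while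
  `∏ aᵢ = wZvY ≤ 224 Z⁶`, so `|Λ| · (∏ aᵢ)^κ ≤ 224^κ Z^{6κ−6}/12 → 0`.  Equivalently: in `hLW` the quantifier `0 < ε` cannot be relaxed
  to `ε₀ < ε` for any `ε₀ < 0` (`not_hLW_matrix_of_neg_eps`) — the conjectured exponent `1` is ATTAINED, `|Λ| ≍ (∏ aᵢ)^{−1}`, by
  value-`1` enemies of the crux's own family (a torus identity; for general `m = 3` forms plain Pell `x² − 2y² = 1` already does this —
  folklore — but not through the dictionary `(w, Z, v, Y)`).
* For the record (docstring only): on an enemy `wZ⁴ = vY⁴ + a₀` one has `|Λ| · ∏ aᵢ ≍ a₀ (v³w)^{1/4} / Z²`, so `LW₄(1)` with a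
  fixed constant fails iff there are enemies strictly BELOW the random-model line `θ + φ = 2` of the two-exponent diagram
  (`Negative.TwoExponentDiagram`); the Pell–Bezout corner `(2, 0)` lies ON that line, which is why it pins the exponent at exactly `1`
  and no further.  So the S⁺5 dial reads: FALSE for `κ < 1` (here); conjectured for every `κ > 1` (Lang–Waldschmidt); sufficient
  for the crux for every `κ < 2` (edge docstring; landed at `κ = 6/5`).  Calibration, not a kill: like `HallLang1728` (pinned at `2`,
  p132424) and `TridentHallLang` (pinned at `5/4`, p133548), the transfer target is used strictly inside its conjectural range.
-/

-- `Summit.ABC.ABC` is the mandated summit-side namespace (CONVENTIONS §2); the duplicate is deliberate.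
set_option linter.dupNamespace false

namespace Summit.ABC.ABC.Theorems.TowerFourSubLiouville.Negative

open scoped BigOperators
open Summit.ABC.ABC.Theorems.TowerFourSubLiouville (lw_sum_eval lw_prod_eval lw_entries_pos lw_coeffs_le)

/-- Sizes along the Pell–Bezout family: `wZvY ≤ 224 Z⁶` and `vY⁴ ≥ 12 Z⁶`. -/
theorem pellBezout_sizes {v w Y Z : ℕ} (hZ : 1 ≤ Z) (hw : w = 16 * Z ^ 2 + 12) (hv : v = 4 * Z ^ 2 - 1)
    (hY : Y ^ 2 = 2 * Z ^ 2 + 1) :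
    w * Z * v * Y ≤ 224 * Z ^ 6 ∧ 12 * Z ^ 6 ≤ v * Y ^ 4 := by
  have hZ2 : 1 ≤ Z ^ 2 := Nat.one_le_pow _ _ hZ
  have hv4 : v ≤ 4 * Z ^ 2 := by rw [hv]; exact Nat.sub_le _ _
  have hv3 : 3 * Z ^ 2 ≤ v := by rw [hv]; omega
  have hw28 : w ≤ 28 * Z ^ 2 := by rw [hw]; omega
  have hY2 : Y ≤ 2 * Z := by
    by_contra hlt
    push Not at hlt
    have : (2 * Z) ^ 2 < Y ^ 2 := Nat.pow_lt_pow_left hlt two_ne_zero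
    nlinarith
  have hY4 : 4 * Z ^ 4 ≤ Y ^ 4 := by
    have : (2 * Z ^ 2) ^ 2 ≤ (Y ^ 2) ^ 2 := Nat.pow_le_pow_left (by rw [hY]; omega) 2
    calc 4 * Z ^ 4 = (2 * Z ^ 2) ^ 2 := by ring
      _ ≤ (Y ^ 2) ^ 2 := this
      _ = Y ^ 4 := by ring
  constructor
  · calc w * Z * v * Y ≤ (28 * Z ^ 2) * Z * (4 * Z ^ 2) * (2 * Z) := by gcongr
      _ = 224 * Z ^ 6 := by ring
  · calc 12 * Z ^ 6 = (3 * Z ^ 2) * (4 * Z ^ 4) := by ring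
      _ ≤ v * Y ^ 4 := by gcongr

/-- **The Lang–Waldschmidt₄ dial is pinned from below at `1` by the crux's own forms.**  For every `κ < 1` there is NO
constant `C > 0` with `C (a₁a₂a₃a₄)^{−κ} ≤ |∑ bᵢ log aᵢ|` for all positive `a : Fin 4 → ℕ`, `|bᵢ| ≤ 4`, non-zero forms — already
for `a = (w, Z, v, Y)`, `b = (1, 4, −1, −4)` along the Pell–Bezout family (`Λ = log(1 + 1/(vY⁴)) ≤ 1/(12Z⁶)`, `∏ aᵢ ≤ 224 Z⁶`).
(Matrix of `hLW` in `stub_cruxOfLangWaldschmidt` verbatim, with `−κ` for `−(1+ε)`.) -/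
theorem not_langWaldschmidt4_of_lt_one {κ : ℝ} (hκ : κ < 1) :
    ¬ ∃ C : ℝ, 0 < C ∧ ∀ a : Fin 4 → ℕ, ∀ b : Fin 4 → ℤ, (∀ i, 0 < a i) → (∀ i, |b i| ≤ 4) →
      (∑ i, (b i : ℝ) * Real.log (a i : ℝ)) ≠ 0 →
      C * (((∏ i, a i : ℕ) : ℝ)) ^ (-κ) ≤ |∑ i, (b i : ℝ) * Real.log (a i : ℝ)| := by
  rintro ⟨C, hC, hLW⟩
  -- push the dial up to `κ' = max κ 0 ∈ [0, 1)`
  set κ' : ℝ := max κ 0 with hκ'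
  have hκ'0 : 0 ≤ κ' := le_max_right _ _
  have hκ'1 : κ' < 1 := max_lt hκ one_pos
  -- growth: eventually `(224^κ' / (6C)) Z^{6κ'} ≤ Z^6`
  obtain ⟨N, hN⟩ := eventually_const_mul_rpow_le ((224 : ℝ) ^ κ' / (6 * C)) (6 * κ') 6 (by linarith)
  -- the family member
  obtain ⟨v, w, Y, Z, hNZ, hv, hw, hY, hZ1, -, hid, -, -, hwdef, hvdef, hY2⟩ := exists_pellBezout N
  obtain ⟨hPle, hBge⟩ := pellBezout_sizes hZ1 hwdef hvdef hY2
  have hZpos : 0 < Z := hZ1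
  -- real coordinates
  have hZr : (0 : ℝ) < Z := by exact_mod_cast hZpos
  have hwr : (0 : ℝ) < w := by exact_mod_cast hw
  have hvr : (0 : ℝ) < v := by exact_mod_cast hv
  have hYr : (0 : ℝ) < Y := by exact_mod_cast hY
  set A : ℝ := (w : ℝ) * (Z : ℝ) ^ 4 with hA
  set B : ℝ := (v : ℝ) * (Y : ℝ) ^ 4 with hB
  have hB0 : 0 < B := by positivity
  have hAB : A = B + 1 := by
    have : ((w * Z ^ 4 : ℕ) : ℝ) = ((v * Y ^ 4 + 1 : ℕ) : ℝ) := by exact_mod_cast hid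
    push_cast at this
    rw [hA, hB]; exact this
  have hA0 : 0 < A := by rw [hAB]; positivity
  -- the linear form `Λ = log A − log B = log (1 + 1/B) ∈ (0, 1/B]`
  have hlogA : Real.log A = Real.log w + 4 * Real.log (Z : ℝ) := by
    rw [hA, Real.log_mul hwr.ne' (pow_pos hZr 4).ne', Real.log_pow]; push_cast; ring
  have hlogB : Real.log B = Real.log v + 4 * Real.log (Y : ℝ) := by
    rw [hB, Real.log_mul hvr.ne' (pow_pos hYr 4).ne', Real.log_pow]; push_cast; ring
  have hΛeval : Real.log w + 4 * Real.log Z - Real.log v - 4 * Real.log Y = Real.log (A / B) := by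
    rw [Real.log_div hA0.ne' hB0.ne', hlogA, hlogB]; ring
  have hquot : A / B = 1 + 1 / B := by
    rw [hAB]; field_simp
  have hquot1 : 1 < A / B := by rw [hquot]; simp [hB0]
  have hΛpos : 0 < Real.log (A / B) := Real.log_pos hquot1
  have hΛle : Real.log (A / B) ≤ 1 / B := by
    have := Real.log_le_sub_one_of_pos (div_pos hA0 hB0)
    rw [hquot] at this ⊢; linarith
  -- the instance of the hypothesis
  have hinst := hLW (![w, Z, v, Y]) (![1, 4, -1, -4]) (lw_entries_pos hw hZpos hv hY) lw_coeffs_le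
    (by rw [lw_sum_eval, hΛeval]; exact hΛpos.ne')
  rw [lw_sum_eval, hΛeval, lw_prod_eval, abs_of_pos hΛpos] at hinst
  -- `P = wZvY`, `1 ≤ P ≤ 224 Z⁶`, `B ≥ 12 Z⁶`
  set P : ℝ := (w : ℝ) * Z * v * Y with hP
  have hP0 : 0 < P := by positivity
  have hP1 : 1 ≤ P := by
    have h : (1 : ℕ) ≤ w * Z * v * Y := Nat.one_le_iff_ne_zero.mpr (by positivity)
    have : ((1 : ℕ) : ℝ) ≤ ((w * Z * v * Y : ℕ) : ℝ) := by exact_mod_cast h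
    push_cast at this
    rw [hP]; exact this
  have hPle' : P ≤ 224 * (Z : ℝ) ^ 6 := by
    have : ((w * Z * v * Y : ℕ) : ℝ) ≤ ((224 * Z ^ 6 : ℕ) : ℝ) := by exact_mod_cast hPle
    push_cast at this
    rw [hP]; exact this
  have hBge' : 12 * (Z : ℝ) ^ 6 ≤ B := by
    have : ((12 * Z ^ 6 : ℕ) : ℝ) ≤ ((v * Y ^ 4 : ℕ) : ℝ) := by exact_mod_cast hBge
    push_cast at this
    rw [hB]; exact this
  -- monotonicity in the dial: `C P^{−κ'} ≤ C P^{−κ} ≤ Λ ≤ 1/B`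
  have hmono : P ^ (-κ') ≤ P ^ (-κ) :=
    Real.rpow_le_rpow_of_exponent_le hP1 (neg_le_neg (le_max_left κ 0))
  have hchain : C * P ^ (-κ') ≤ 1 / B :=
    le_trans (mul_le_mul_of_nonneg_left hmono hC.le) (hinst.trans hΛle)
  -- but `P^{κ'} ≤ 224^{κ'} Z^{6κ'} ≤ 6 C Z⁶ < C B`, i.e. `1/B < C P^{−κ'}`
  have hgrow := hN Z hNZ
  have hZ6 : (Z : ℝ) ^ (6 : ℝ) = (Z : ℝ) ^ (6 : ℕ) := by
    rw [← Real.rpow_natCast]; norm_num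
  rw [hZ6] at hgrow
  have hPk : P ^ κ' ≤ (224 : ℝ) ^ κ' * (Z : ℝ) ^ (6 * κ') := by
    calc P ^ κ' ≤ (224 * (Z : ℝ) ^ 6) ^ κ' := Real.rpow_le_rpow hP0.le hPle' hκ'0
      _ = (224 : ℝ) ^ κ' * ((Z : ℝ) ^ 6) ^ κ' := Real.mul_rpow (by norm_num) (by positivity)
      _ = (224 : ℝ) ^ κ' * (Z : ℝ) ^ (6 * κ') := by
          rw [← Real.rpow_natCast (Z : ℝ) 6, ← Real.rpow_mul hZr.le]; push_cast; ring_nf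
  have h224 : 0 < (224 : ℝ) ^ κ' := Real.rpow_pos_of_pos (by norm_num) _
  have hPk' : P ^ κ' < C * B := by
    have h1 : (224 : ℝ) ^ κ' * (Z : ℝ) ^ (6 * κ') ≤ 6 * C * (Z : ℝ) ^ 6 := by
      have h2 : (224 : ℝ) ^ κ' / (6 * C) * (Z : ℝ) ^ (6 * κ') ≤ (Z : ℝ) ^ 6 := hgrow
      rw [div_mul_eq_mul_div, div_le_iff₀ (by positivity)] at h2
      linarith
    have h3 : 6 * C * (Z : ℝ) ^ 6 < C * B := by
      have hZ6pos : 0 < (Z : ℝ) ^ 6 := by positivity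
      nlinarith
    linarith
  have hcontra : 1 / B < C * P ^ (-κ') := by
    rw [Real.rpow_neg hP0.le, ← div_eq_mul_inv, div_lt_div_iff₀ hB0 (Real.rpow_pos_of_pos hP0 κ')]
    linarith
  linarith

/-- **In `hLW` the `ε` cannot go negative**: the matrix of `stub_cruxOfLangWaldschmidt`'s hypothesis at any fixed `ε < 0` is
false (take `κ = 1 + ε < 1`).  The edge uses `ε = 1/5`; the conjecture asserts every `ε > 0`. -/
theorem not_hLW_matrix_of_neg_eps {ε : ℝ} (hε : ε < 0) :
    ¬ ∃ C : ℝ, 0 < C ∧ ∀ a : Fin 4 → ℕ, ∀ b : Fin 4 → ℤ, (∀ i, 0 < a i) → (∀ i, |b i| ≤ 4) →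
      (∑ i, (b i : ℝ) * Real.log (a i : ℝ)) ≠ 0 →
      C * (((∏ i, a i : ℕ) : ℝ)) ^ (-(1 + ε)) ≤ |∑ i, (b i : ℝ) * Real.log (a i : ℝ)| :=
  not_langWaldschmidt4_of_lt_one (by linarith)

/-- The smallest member, for the record: `a = (76, 2, 15, 3)`, `b = (1, 4, −1, −4)`: `76·2⁴ = 1216 = 15·3⁴ + 1`, so
`Λ = log(1216/1215) ≈ 8.2·10⁻⁴` while `∏ aᵢ = 6840` and `1/6840 ≈ 1.5·10⁻⁴`: `|Λ| · ∏ aᵢ ≈ 5.6` (the family constant is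
`≍ 224/12`-bounded). -/
example : (76 : ℕ) * 2 ^ 4 = 15 * 3 ^ 4 + 1 ∧ (76 : ℕ) * 2 * 15 * 3 = 6840 := by norm_num

end Summit.ABC.ABC.Theorems.TowerFourSubLiouville.Negative
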